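import Summits.CriticalPhenomena.PercolationContinuityZ3.Theorems.PercNearOneGluingNoHeavyLowerTailUniformCertLeFiveChecker

/-!
# `NoHeavyLowerTail` (crux stmt-CriticalPhenomena-4575 ≡ KN Conjecture 3), certificate programme:
# additive gluing, the reach-difference bound and Kozma–Nitzan's Conjecture 1 at EVERY uniform
# density on all simple graphs with at most five vertices (the level-count certificate)

Continuation of `…UniformCertLeFiveChecker.lean` (the computable level-count checker `lvGraph` /
`lvAll` and the soundness of its data).  Here, sorry-free with the standard axioms plus
`Lean.ofReduceBool` confined to the six evaluations `lvAll_zero … lvAll_five`: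

* Part 1 (every density, any finite coordinate set): `levelSum_mul_levelSum`
  (`(Σ_i u_i x^i y^{m-i})(Σ_j v_j x^j y^{m-j}) = Σ_{s ≤ 2m} (Σ_{i+j=s} u_i v_j) x^s y^{2m-s}`),
  `levelSum_mul_levelSum_le`, and `uniformOn_real_mul_le_of_conv_le`: convolution dominance of the level
  counts, `Σ_{i+j=s} #_i(D₁) #_j(D₂) ≤ Σ_{i+j=s} #_i(D₃) C(|E|, j)` for all `s`, gives
  `P_p(D₁) P_p(D₂) ≤ P_p(D₃)` for EVERY `p` (as `P_p(D₃) = P_p(D₃) (p + (1 − p))^{|E|}`).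
* Part 2 (the three consequences of `lvGraph n (edgeList G) = true` for `bondPercolation G p`, every
  `p`): `real_diff_le_of_lvGraph` (the relay: `P({o ↔ A} ∖ {o ↔ b}) ≤ 1 − P(a ↔ b)` by level-wise
  dominance and `uniformOn_real_mono_of_levelCount_le`), `additiveGluing_uniform_of_lvGraph`,
  `reachDiff_uniform_of_lvGraph`, `knConj1_uniform_of_lvGraph`; the triples the checker skips
  (`o ∈ A`, `o = b`, `A = ∅`) are discharged by `P ≤ 1`, `P(o ↔ o) = 1`, `P(∅) = 0`.
* Part 3, THE CERTIFICATE: `lvAll_five : lvAll 5 = true` (`native_decide`; 1024 graphs, 59 049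
  sub-configurations, ≈ 50 s compiled) and the smaller `n`, hence the registered stubs
  `additiveGluing_uniform_le_five`, `reachDiff_uniform_le_five`, `knConj1_uniform_le_five`:
  for every `n ≤ 5`, every `G : SimpleGraph (Fin n)`, EVERY `p ∈ [0, 1]` and all `A o b`:
  `P_p(o ↔ A) − t ≤ P_p(o ↔ b)` if `t ≥ 0` and `P_p(a ↔ b) ≥ 1 − t` on `A`;
  `P_p({o ↔ A} ∖ {o ↔ a₀}) ≤ η` if `a₀ ∈ A` and `P_p(a ↔ a₀) ≥ 1 − η` on `A`;
  `P_p(o ↔ A) · s ≤ P_p(o ↔ b)` if `s ≤ P_p(a ↔ b)` on `A` (Kozma–Nitzan's Conjecture 1 on this window).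

The lead checked off-tree that level-wise (AG) and convolution (KN) dominance hold with one relay on
every instance with `n ≤ 5`; this file makes that kernel-checked.  Nothing here asserts the crux.
-/

namespace Summit.CriticalPhenomena.PercolationContinuityZ3.Theorems

open MeasureTheory
open Literature.Probability.LatticeModels Literature.Probability.Percolation
open Summit.CriticalPhenomena.PercolationContinuityZ3.Theorems.AdditiveGluing.Negative.Cert

/-! ## Part 1. Convolution dominance at every density -/

/-- The product of two level sums is the level sum of the convolution:
`(Σ_i u_i x^i y^{m-i})(Σ_j v_j x^j y^{m-j}) = Σ_{s ≤ 2m} (Σ_{i+j=s} u_i v_j) x^s y^{2m-s}`. [folklore] -/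
theorem levelSum_mul_levelSum (m : ℕ) (u v : ℕ → ℝ) (x y : ℝ) :
    (∑ i ∈ Finset.range (m + 1), u i * x ^ i * y ^ (m - i)) *
        (∑ j ∈ Finset.range (m + 1), v j * x ^ j * y ^ (m - j)) =
      ∑ s ∈ Finset.range (2 * m + 1), (∑ i ∈ Finset.range (m + 1), ∑ j ∈ Finset.range (m + 1),
        if i + j = s then u i * v j else 0) * x ^ s * y ^ (2 * m - s) := by
  rw [Finset.sum_mul_sum]
  have hterm : ∀ i ∈ Finset.range (m + 1), ∀ j ∈ Finset.range (m + 1),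
      u i * x ^ i * y ^ (m - i) * (v j * x ^ j * y ^ (m - j)) =
        ∑ s ∈ Finset.range (2 * m + 1),
          (if i + j = s then u i * v j else 0) * x ^ s * y ^ (2 * m - s) := by
    intro i hi j hj
    rw [Finset.mem_range] at hi hj
    have hre : ∀ s ∈ Finset.range (2 * m + 1),
        (if i + j = s then u i * v j else 0) * x ^ s * y ^ (2 * m - s) =
          if i + j = s then u i * v j * x ^ s * y ^ (2 * m - s) else 0 := fun s _ => by
      split_ifs <;> ring
    rw [Finset.sum_congr rfl hre, Finset.sum_ite_eq, if_pos (Finset.mem_range.2 (by omega))]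
    have : 2 * m - (i + j) = (m - i) + (m - j) := by omega
    rw [this, pow_add, pow_add]
    ring
  rw [Finset.sum_congr rfl fun i hi => Finset.sum_congr rfl fun j hj => hterm i hi j hj,
    Finset.sum_congr rfl fun i _ => Finset.sum_comm, Finset.sum_comm]
  refine Finset.sum_congr rfl fun s _ => ?_
  rw [Finset.sum_mul, Finset.sum_mul]
  refine Finset.sum_congr rfl fun i _ => ?_
  rw [Finset.sum_mul, Finset.sum_mul]

/-- Coefficient-wise dominance of the convolutions gives dominance of the products of the level
sums, for `x, y ≥ 0` and natural coefficients. [folklore] -/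
theorem levelSum_mul_levelSum_le (m : ℕ) (u v u' v' : ℕ → ℕ) {x y : ℝ} (hx : 0 ≤ x) (hy : 0 ≤ y)
    (h : ∀ s, s < 2 * m + 1 →
      (∑ i ∈ Finset.range (m + 1), ∑ j ∈ Finset.range (m + 1), if i + j = s then u i * v j else 0) ≤
        ∑ i ∈ Finset.range (m + 1), ∑ j ∈ Finset.range (m + 1), if i + j = s then u' i * v' j else 0) :
    (∑ i ∈ Finset.range (m + 1), (u i : ℝ) * x ^ i * y ^ (m - i)) *
        (∑ j ∈ Finset.range (m + 1), (v j : ℝ) * x ^ j * y ^ (m - j)) ≤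
      (∑ i ∈ Finset.range (m + 1), (u' i : ℝ) * x ^ i * y ^ (m - i)) *
        (∑ j ∈ Finset.range (m + 1), (v' j : ℝ) * x ^ j * y ^ (m - j)) := by
  rw [levelSum_mul_levelSum m (fun i => (u i : ℝ)) (fun j => (v j : ℝ)),
    levelSum_mul_levelSum m (fun i => (u' i : ℝ)) (fun j => (v' j : ℝ))]
  refine Finset.sum_le_sum fun s hs => ?_
  have hw : 0 ≤ x ^ s * y ^ (2 * m - s) := mul_nonneg (pow_nonneg hx _) (pow_nonneg hy _)
  have hc : (∑ i ∈ Finset.range (m + 1), ∑ j ∈ Finset.range (m + 1),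
      (if i + j = s then (u i : ℝ) * (v j : ℝ) else 0)) ≤
      ∑ i ∈ Finset.range (m + 1), ∑ j ∈ Finset.range (m + 1),
        (if i + j = s then (u' i : ℝ) * (v' j : ℝ) else 0) := by
    have := h s (Finset.mem_range.1 hs)
    exact_mod_cast this
  calc _ = (∑ i ∈ Finset.range (m + 1), ∑ j ∈ Finset.range (m + 1),
        (if i + j = s then (u i : ℝ) * (v j : ℝ) else 0)) * (x ^ s * y ^ (2 * m - s)) := by ring
    _ ≤ (∑ i ∈ Finset.range (m + 1), ∑ j ∈ Finset.range (m + 1),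
        (if i + j = s then (u' i : ℝ) * (v' j : ℝ) else 0)) * (x ^ s * y ^ (2 * m - s)) :=
        mul_le_mul_of_nonneg_right hc hw
    _ = _ := by ring

open Classical in
/-- **Convolution dominance ⟹ product dominance at every density.** If for every `s ≤ 2|E|`
`Σ_{i+j=s} #_i(D₁) #_j(D₂) ≤ Σ_{i+j=s} #_i(D₃) C(|E|, j)`, then `P_p(D₁) · P_p(D₂) ≤ P_p(D₃)` under the
weights `p · 𝟙_E`, for every `p ∈ [0,1]` (since `P_p(D₃) = P_p(D₃) · (p + (1-p))^{|E|}`). [folklore] -/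
theorem uniformOn_real_mul_le_of_conv_le {ι : Type} [Fintype ι] [DecidableEq ι] (E : Finset ι)
    (p : unitInterval) (D₁ D₂ D₃ : Set (Set ι))
    (h : ∀ s, s < 2 * E.card + 1 →
      (∑ i ∈ Finset.range (E.card + 1), ∑ j ∈ Finset.range (E.card + 1), if i + j = s then
        (E.powerset.filter fun S : Finset ι => S.card = i ∧ (↑S : Set ι) ∈ D₁).card *
          (E.powerset.filter fun S : Finset ι => S.card = j ∧ (↑S : Set ι) ∈ D₂).card else 0) ≤
      ∑ i ∈ Finset.range (E.card + 1), ∑ j ∈ Finset.range (E.card + 1), if i + j = s then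
        (E.powerset.filter fun S : Finset ι => S.card = i ∧ (↑S : Set ι) ∈ D₃).card * E.card.choose j
        else 0) :
    (prodBernoulli (fun i => if i ∈ E then p else 0)).real D₁ *
        (prodBernoulli (fun i => if i ∈ E then p else 0)).real D₂ ≤
      (prodBernoulli (fun i => if i ∈ E then p else 0)).real D₃ := by
  have hp0 : 0 ≤ (p : ℝ) := p.2.1
  have hp1 : 0 ≤ 1 - (p : ℝ) := sub_nonneg.2 p.2.2
  have hone : ∑ j ∈ Finset.range (E.card + 1),
      ((E.card.choose j : ℕ) : ℝ) * (p : ℝ) ^ j * (1 - (p : ℝ)) ^ (E.card - j) = 1 := by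
    calc _ = ∑ j ∈ Finset.range (E.card + 1),
          (p : ℝ) ^ j * (1 - (p : ℝ)) ^ (E.card - j) * ((E.card.choose j : ℕ) : ℝ) :=
          Finset.sum_congr rfl fun j _ => by ring
      _ = ((p : ℝ) + (1 - p)) ^ E.card := (add_pow _ _ _).symm
      _ = 1 := by rw [add_sub_cancel, one_pow]
  rw [uniformOn_real_eq_levelSum E p D₁, uniformOn_real_eq_levelSum E p D₂,
    uniformOn_real_eq_levelSum E p D₃]
  calc _ ≤ _ := levelSum_mul_levelSum_le E.card
        (fun i => (E.powerset.filter fun S : Finset ι => S.card = i ∧ (↑S : Set ι) ∈ D₁).card)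
        (fun j => (E.powerset.filter fun S : Finset ι => S.card = j ∧ (↑S : Set ι) ∈ D₂).card)
        (fun i => (E.powerset.filter fun S : Finset ι => S.card = i ∧ (↑S : Set ι) ∈ D₃).card)
        (fun j => E.card.choose j) hp0 hp1 h
    _ = _ := by rw [hone, mul_one]

/-! ## Part 2. The three consequences of `lvGraph n (edgeList G) = true`, at every density -/

/-- The mask of a finite vertex set misses `o ∉ A`. -/
theorem testBit_maskL_eq_false {n : ℕ} {A : Finset (Fin n)} {o : Fin n} (ho : o ∉ A) :
    (maskL A.toList).testBit o = false := by
  rw [Bool.eq_false_iff]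
  intro h
  obtain ⟨a, ha, hao⟩ := (testBit_maskL A.toList o).1 h
  exact ho (Fin.ext hao ▸ Finset.mem_toList.1 ha)

/-- The mask of a non-empty vertex set is non-zero. -/
theorem maskL_ne_zero {n : ℕ} {A : Finset (Fin n)} {a : Fin n} (ha : a ∈ A) : maskL A.toList ≠ 0 := by
  intro h0
  have := (testBit_maskL A.toList a).2 ⟨a, Finset.mem_toList.2 ha, rfl⟩
  rw [h0, Nat.zero_testBit] at this
  exact Bool.false_ne_true this

/-- A set bit of the mask is a member. -/
theorem mem_of_testBit_maskL {n : ℕ} {A : Finset (Fin n)} {a : Fin n}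
    (h : (maskL A.toList).testBit a = true) : a ∈ A := by
  obtain ⟨a', ha', haa'⟩ := (testBit_maskL A.toList a).1 h
  rw [← Fin.ext haa']; exact Finset.mem_toList.1 ha'

/-- `P(o ↔ o) = 1`. -/
theorem real_openConn_self {n : ℕ} (μ : Measure (Set (Sym2 (Fin n)))) [IsProbabilityMeasure μ] (o : Fin n) :
    μ.real (openConn o o) = 1 := by
  have : openConn o o = (Set.univ : Set (Set (Sym2 (Fin n)))) :=
    Set.eq_univ_of_forall fun _ => SimpleGraph.Reachable.refl _
  rw [this, probReal_univ]

open Classical in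
/-- The level certificate's relay at the measure level: for `o ∉ A`, `o ≠ b`, `A ≠ ∅` some `a ∈ A`
has `P_p({o ↔ A} ∖ {o ↔ b}) ≤ 1 − P_p(a ↔ b)` for EVERY `p` (level-wise dominance
`#_k{o ↔ A, o ↮ b} ≤ #_k{a ↮ b}` and `uniformOn_real_mono_of_levelCount_le`). -/
theorem real_diff_le_of_lvGraph {n : ℕ} (G : SimpleGraph (Fin n)) (hg : lvGraph n (edgeList G) = true)
    (p : unitInterval) (A : Finset (Fin n)) (o b : Fin n) (hoA : o ∉ A) (hob : o ≠ b) {a₀ : Fin n}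
    (ha₀ : a₀ ∈ A) :
    ∃ a ∈ A, (bondPercolation G p).real ((⋃ a ∈ A, openConn o a) \ openConn o b) ≤
      1 - (bondPercolation G p).real (openConn a b) := by
  set es := edgeList G with hes
  have hnd : (es.map mkE).Nodup := nodup_map_mk_of_sublist (edgeList_sublist G)
  obtain ⟨a, hta, hle⟩ := lvGraph_specAG hg o b hob (maskL_lt A.toList) (maskL_ne_zero ha₀)
    (testBit_maskL_eq_false hoA)
  refine ⟨a, mem_of_testBit_maskL hta, ?_⟩
  rw [← probReal_compl_eq_one_sub (measurableSet_openConn_holds a b),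
    bondPercolation_eq_prodBernoulli_uniformOn G p, ← hes]
  set D₁ : Set (Set (Sym2 (Fin n))) := (⋃ a ∈ A, openConn o a) \ openConn o b with hD₁
  have hQ₁ : ∀ ω : List (Fin n × Fin n),
      (fun T => T &&& maskL A.toList != 0 && !T.testBit b) ((reachTable n ω).getD o 0) = true ↔
        (↑(Eset ω) : Set (Sym2 (Fin n))) ∈ D₁ := fun ω => by
    rw [Bool.and_eq_true, and_maskL_iff_mem_iUnion, Bool.not_eq_true', Bool.eq_false_iff, ne_eq,
      testBit_reachTable_iff_mem_openConn, hD₁, Set.mem_sdiff]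
  have hQ₂ : ∀ ω : List (Fin n × Fin n), (fun T => T.testBit b) ((reachTable n ω).getD a 0) = true ↔
      (↑(Eset ω) : Set (Sym2 (Fin n))) ∈ openConn a b :=
    fun ω => testBit_reachTable_iff_mem_openConn ω a b
  refine uniformOn_real_mono_of_levelCount_le (Eset es) p D₁ (openConn a b)ᶜ fun k => ?_
  by_cases hk : k ≤ es.length
  · have h1 := hle k hk
    rw [lvCnt_eq_card hnd o _ D₁ hQ₁, lvCnt_eq_card hnd a _ (openConn a b) hQ₂,
      ← length_eq_card_Eset hnd] at h1
    have h2 := levelCount_add_compl (Eset es) (openConn a b) (openConn a b)ᶜ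
      (fun S => Set.mem_compl_iff _ _) k
    omega
  · have h0 := levelCount_eq_zero (Eset es) D₁ (k := k) (by rw [length_eq_card_Eset hnd]; omega)
    omega

/-- **Additive gluing at every density from the level certificate.** If `lvGraph n (edgeList G)`
holds then for every `p`, `A`, `o`, `b`, `t ≥ 0` with `P_p(a ↔ b) ≥ 1 − t` on `A`:
`P_p(o ↔ A) − t ≤ P_p(o ↔ b)` (`P(o ↔ A) ≤ P(o ↔ A, o ↮ b) + P(o ↔ b)` and the relay bound; the
triples skipped by the checker — `o ∈ A`, `o = b`, `A = ∅` — hold by `P ≤ 1`, `P(o ↔ o) = 1`, `P(∅) = 0`). -/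
theorem additiveGluing_uniform_of_lvGraph {n : ℕ} (G : SimpleGraph (Fin n))
    (hg : lvGraph n (edgeList G) = true) (p : unitInterval) (A : Finset (Fin n)) (o b : Fin n) (t : ℝ)
    (ht : 0 ≤ t) (hrel : ∀ a ∈ A, 1 - t ≤ (bondPercolation G p).real (openConn a b)) :
    (bondPercolation G p).real (⋃ a ∈ A, openConn o a) - t ≤ (bondPercolation G p).real (openConn o b) := by
  have hPA : (bondPercolation G p).real (⋃ a ∈ A, openConn o a) ≤ 1 := measureReal_le_one
  by_cases hoA : o ∈ A
  · linarith [hrel o hoA]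
  by_cases hob : o = b
  · subst hob; rw [real_openConn_self]; linarith
  by_cases hA : A = ∅
  · subst hA
    simp only [Finset.notMem_empty, Set.iUnion_of_empty, Set.iUnion_empty, measureReal_empty]
    linarith [measureReal_nonneg (μ := bondPercolation G p) (s := openConn o b)]
  obtain ⟨a0, ha0⟩ := Finset.nonempty_iff_ne_empty.2 hA
  obtain ⟨a, haA, hle⟩ := real_diff_le_of_lvGraph G hg p A o b hoA hob ha0
  have hsplit : (bondPercolation G p).real (⋃ a ∈ A, openConn o a) ≤
      (bondPercolation G p).real ((⋃ a ∈ A, openConn o a) \ openConn o b) +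
        (bondPercolation G p).real (openConn o b) :=
    (measureReal_mono (fun ω hω => by
      by_cases hb : ω ∈ openConn o b
      · exact Or.inr hb
      · exact Or.inl ⟨hω, hb⟩)).trans (measureReal_union_le _ _)
  linarith [hrel a haA]

/-- **Reach-difference bound at every density from the level certificate.** If
`lvGraph n (edgeList G)` holds then for every `p`, `A ∋ a₀`, `o`, `η` with `P_p(a ↔ a₀) ≥ 1 − η` on `A`:
`P_p({o ↔ A} ∖ {o ↔ a₀}) ≤ η` (relay bound with `b := a₀`; for `o ∈ A` use `{o ↔ A} ∖ {o ↔ a₀} ⊆ {o ↮ a₀}`). -/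
theorem reachDiff_uniform_of_lvGraph {n : ℕ} (G : SimpleGraph (Fin n))
    (hg : lvGraph n (edgeList G) = true) (p : unitInterval) (A : Finset (Fin n)) (o a₀ : Fin n) (η : ℝ)
    (ha₀ : a₀ ∈ A) (hrel : ∀ a ∈ A, 1 - η ≤ (bondPercolation G p).real (openConn a a₀)) :
    (bondPercolation G p).real ((⋃ a ∈ A, openConn o a) \ openConn o a₀) ≤ η := by
  by_cases hoA : o ∈ A
  · have h1 : (bondPercolation G p).real ((⋃ a ∈ A, openConn o a) \ openConn o a₀) ≤
        (bondPercolation G p).real (openConn o a₀)ᶜ := measureReal_mono fun ω hω => hω.2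
    rw [probReal_compl_eq_one_sub (measurableSet_openConn_holds o a₀)] at h1
    linarith [hrel o hoA]
  obtain ⟨a, haA, hle⟩ := real_diff_le_of_lvGraph G hg p A o a₀ hoA (fun h => hoA (h ▸ ha₀)) ha₀
  linarith [hrel a haA]

open Classical in
/-- **Kozma–Nitzan Conjecture 1 at every density from the level certificate.** If
`lvGraph n (edgeList G)` holds then for every `p`, `A`, `o`, `b`, `s` with `s ≤ P_p(a ↔ b)` on `A`:
`P_p(o ↔ A) · s ≤ P_p(o ↔ b)` (relay `a`: `P(o ↔ A) P(a ↔ b) ≤ P(o ↔ b)` by convolution dominance). -/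
theorem knConj1_uniform_of_lvGraph {n : ℕ} (G : SimpleGraph (Fin n))
    (hg : lvGraph n (edgeList G) = true) (p : unitInterval) (A : Finset (Fin n)) (o b : Fin n) (s : ℝ)
    (hrel : ∀ a ∈ A, s ≤ (bondPercolation G p).real (openConn a b)) :
    (bondPercolation G p).real (⋃ a ∈ A, openConn o a) * s ≤ (bondPercolation G p).real (openConn o b) := by
  have hPA0 : 0 ≤ (bondPercolation G p).real (⋃ a ∈ A, openConn o a) := measureReal_nonneg
  have hPA1 : (bondPercolation G p).real (⋃ a ∈ A, openConn o a) ≤ 1 := measureReal_le_one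
  have hPb0 : 0 ≤ (bondPercolation G p).real (openConn o b) := measureReal_nonneg
  -- a trivial bound used twice: `P(o ↔ A) · s ≤ max s 0`
  have htriv : ∀ x : ℝ, s ≤ x → 0 ≤ x → (bondPercolation G p).real (⋃ a ∈ A, openConn o a) * s ≤ x := by
    intro x hsx hx
    by_cases hs : 0 ≤ s
    · exact (mul_le_of_le_one_left hs hPA1).trans hsx
    · exact (mul_nonpos_of_nonneg_of_nonpos hPA0 (le_of_lt (not_le.1 hs))).trans hx
  by_cases hA : A = ∅
  · subst hA
    simp only [Finset.notMem_empty, Set.iUnion_of_empty, Set.iUnion_empty, measureReal_empty, zero_mul]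
    exact hPb0
  obtain ⟨a0, ha0⟩ := Finset.nonempty_iff_ne_empty.2 hA
  by_cases hoA : o ∈ A
  · exact htriv _ (hrel o hoA) hPb0
  by_cases hob : o = b
  · subst hob
    rw [real_openConn_self]
    exact htriv 1 ((hrel a0 ha0).trans measureReal_le_one) zero_le_one
  set es := edgeList G with hes
  have hnd : (es.map mkE).Nodup := nodup_map_mk_of_sublist (edgeList_sublist G)
  obtain ⟨a, hta, hle⟩ := lvGraph_specKN hg o b hob (maskL_lt A.toList) (maskL_ne_zero ha0)
    (testBit_maskL_eq_false hoA)
  have haA : a ∈ A := mem_of_testBit_maskL hta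
  rw [bondPercolation_eq_prodBernoulli_uniformOn G p] at hrel hPA0 ⊢
  rw [← hes] at hrel hPA0 ⊢
  have e1 : ∀ i, lvCnt n es o (fun T => T &&& maskL A.toList != 0) i =
      ((Eset es).powerset.filter fun S : Finset (Sym2 (Fin n)) =>
        S.card = i ∧ (↑S : Set (Sym2 (Fin n))) ∈ ⋃ a ∈ A, openConn o a).card :=
    lvCnt_eq_card hnd o _ _ fun ω => and_maskL_iff_mem_iUnion ω o A
  have e2 : ∀ j, lvCnt n es a (fun T => T.testBit b) j =
      ((Eset es).powerset.filter fun S : Finset (Sym2 (Fin n)) =>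
        S.card = j ∧ (↑S : Set (Sym2 (Fin n))) ∈ openConn a b).card :=
    lvCnt_eq_card hnd a _ _ fun ω => testBit_reachTable_iff_mem_openConn ω a b
  have e3 : ∀ i, lvCnt n es o (fun T => T.testBit b) i =
      ((Eset es).powerset.filter fun S : Finset (Sym2 (Fin n)) =>
        S.card = i ∧ (↑S : Set (Sym2 (Fin n))) ∈ openConn o b).card :=
    lvCnt_eq_card hnd o _ _ fun ω => testBit_reachTable_iff_mem_openConn ω o b
  simp only [e1, e2, e3, ← length_eq_card_Eset hnd] at hle
  have hprod := uniformOn_real_mul_le_of_conv_le (Eset es) p (⋃ a ∈ A, openConn o a) (openConn a b)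
    (openConn o b) hle
  exact (mul_le_mul_of_nonneg_left (hrel a haA) hPA0).trans hprod

/-! ## Part 3. The certificate: all simple graphs on at most five vertices -/

/-- `lvAll 0 = true` (no vertices). -/
theorem lvAll_zero : lvAll 0 = true := by native_decide

/-- `lvAll 1 = true`. -/
theorem lvAll_one : lvAll 1 = true := by native_decide

/-- `lvAll 2 = true`. -/
theorem lvAll_two : lvAll 2 = true := by native_decide

/-- `lvAll 3 = true` (8 graphs). -/
theorem lvAll_three : lvAll 3 = true := by native_decide

/-- `lvAll 4 = true` (64 graphs). -/
theorem lvAll_four : lvAll 4 = true := by native_decide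

/-- **The certified computation** `lvAll 5 = true` (1024 graphs, 59 049 sub-configurations,
level histograms and both dominance tests for every `(o, b, A)`; `native_decide`, ≈ 50 s compiled). -/
theorem lvAll_five : lvAll 5 = true := by native_decide

/-- `lvAll n = true` for every `n ≤ 5`. -/
theorem lvAll_le_five {n : ℕ} (hn : n ≤ 5) : lvAll n = true := by
  interval_cases n
  · exact lvAll_zero
  · exact lvAll_one
  · exact lvAll_two
  · exact lvAll_three
  · exact lvAll_four
  · exact lvAll_five

/-- `lvAll n` covers the edge list of every simple graph on `Fin n`. -/
theorem lvGraph_edgeList_of_lvAll {n : ℕ} (h : lvAll n = true) (G : SimpleGraph (Fin n)) :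
    lvGraph n (edgeList G) = true :=
  List.all_eq_true.1 h _ (List.mem_sublists'.2 (edgeList_sublist G))

/-- **Certificate (additive gluing, every density, at most five vertices).** For every simple graph
`G` on `Fin n`, `n ≤ 5`, Bernoulli bond percolation with ANY parameter `p`, every relay set `A`,
vertices `o b` and slack `t ≥ 0` with `P_p(a ↔ b) ≥ 1 − t` for all `a ∈ A`:
`P_p(o ↔ A) − t ≤ P_p(o ↔ b)`. -/
theorem additiveGluing_uniform_le_five : ∀ (n : ℕ), n ≤ 5 → ∀ (G : SimpleGraph (Fin n)) (p : unitInterval) (A : Finset (Fin n)) (o b : Fin n) (t : ℝ), 0 ≤ t → (∀ a ∈ A, 1 - t ≤ (Literature.Probability.Percolation.bondPercolation G p).real (Literature.Probability.Percolation.openConn a b)) → (Literature.Probability.Percolation.bondPercolation G p).real (⋃ a ∈ A, Literature.Probability.Percolation.openConn o a) - t ≤ (Literature.Probability.Percolation.bondPercolation G p).real (Literature.Probability.Percolation.openConn o b) := by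
  intro n hn G p A o b t ht hrel
  exact additiveGluing_uniform_of_lvGraph G (lvGraph_edgeList_of_lvAll (lvAll_le_five hn) G) p A o b t
    ht hrel

/-- **Certificate (reach-difference bound, every density, at most five vertices).** For every simple
graph `G` on `Fin n`, `n ≤ 5`, ANY `p`, every `A ∋ a₀`, `o` and `η` with `P_p(a ↔ a₀) ≥ 1 − η` for all
`a ∈ A`: `P_p({o ↔ A} ∖ {o ↔ a₀}) ≤ η`. -/
theorem reachDiff_uniform_le_five : ∀ (n : ℕ), n ≤ 5 → ∀ (G : SimpleGraph (Fin n)) (p : unitInterval) (A : Finset (Fin n)) (o a₀ : Fin n) (η : ℝ), a₀ ∈ A → (∀ a ∈ A, 1 - η ≤ (Literature.Probability.Percolation.bondPercolation G p).real (Literature.Probability.Percolation.openConn a a₀)) → (Literature.Probability.Percolation.bondPercolation G p).real ((⋃ a ∈ A, Literature.Probability.Percolation.openConn o a) \ Literature.Probability.Percolation.openConn o a₀) ≤ η := by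
  intro n hn G p A o a₀ η ha₀ hrel
  exact reachDiff_uniform_of_lvGraph G (lvGraph_edgeList_of_lvAll (lvAll_le_five hn) G) p A o a₀ η ha₀
    hrel

/-- **Certificate (Kozma–Nitzan Conjecture 1, every density, at most five vertices).** For every
simple graph `G` on `Fin n`, `n ≤ 5`, ANY `p`, all `A o b s` with `s ≤ P_p(a ↔ b)` for all `a ∈ A`:
`P_p(o ↔ A) · s ≤ P_p(o ↔ b)`, i.e. `P_p(o ↔ b) ≥ P_p(o ↔ A) · min_{a ∈ A} P_p(a ↔ b)`. -/
theorem knConj1_uniform_le_five : ∀ (n : ℕ), n ≤ 5 → ∀ (G : SimpleGraph (Fin n)) (p : unitInterval) (A : Finset (Fin n)) (o b : Fin n) (s : ℝ), (∀ a ∈ A, s ≤ (Literature.Probability.Percolation.bondPercolation G p).real (Literature.Probability.Percolation.openConn a b)) → (Literature.Probability.Percolation.bondPercolation G p).real (⋃ a ∈ A, Literature.Probability.Percolation.openConn o a) * s ≤ (Literature.Probability.Percolation.bondPercolation G p).real (Literature.Probability.Percolation.openConn o b) := by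
  intro n hn G p A o b s hrel
  exact knConj1_uniform_of_lvGraph G (lvGraph_edgeList_of_lvAll (lvAll_le_five hn) G) p A o b s hrel

end Summit.CriticalPhenomena.PercolationContinuityZ3.Theorems
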